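/-
Copyright (c) 2026. Released under Apache 2.0 license as described in the file LICENSE.
-/
import Summits.RiemannHypothesis.RiemannHypothesis.Theorems.LiKernelTaylorCert
import Summits.RiemannHypothesis.RiemannHypothesis.Theorems.LiKernelTableCorollaries
import Literature.NumberTheory.LFunctions.KeiperLiAsymptoticCriteriaProofs
import HarnessLib

/-!
# KERNEL LINEAGE K, Taylor side: soundness and the exported rows

RH-FREE DATA.  bears_on: LADDER-RH L-D (a) (COLUMN 4 LI, DATA rung).  WHAT THIS IS NOT: numbers, not
evidence for RH; finite-range instances of Coffey's conjecture are data, not a proof of it; nothing here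
bears on the truth of RH.

What the kernel certificate `certT` (`LiKernelTaylorCert.lean`) certifies:

* `stieltjesGamma_mem_row` — the Stieltjes constants `γₙ ∈ [gLo n, gHi n]·10^{−gDigits n}`, `0 ≤ n ≤ 36`
  (`γ₀ = γ`; `γ₁ = −0.0728158454836767248605863758749013191377363383…`);
* `liEta_mem_row` — the Bombieri–Lagarias/Coffey coefficients `ηₖ ∈ [eLo k, eHi k]·10^{−eDigits k}`,
  `0 ≤ k ≤ 91`;
* `liEta_alternating_of_le` — `(−1)^{k+1} ηₖ > 0` for `k ≤ 91` (finite kernel instances of Coffey 2005,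
  Conj. 1 (iv), arXiv:math-ph/0505052 p. 5 — proved for all `j` in print by Coffey 2006);
* `abs_liEta_le_of_le` — `|ηₖ| ≤ γ·2^{−k}` for `k ≤ 91` (instances of Conj. 1 (iii), printed as a
  conjecture; the kernel margin is `|ηₖ| 2ᵏ ≤ 0.5772 < γ` for `k ≥ 1`, equality `|η₀| = γ` at `k = 0`);
* `stieltjesGamma_one_mem`, `liEta_one_mem` — two rows in decimals.

Chain: `uList_spec`/`qList_spec` (`Xiao2020.Refutation`); `u_{n+1} = (−1)ⁿ γₙ/n!` (`Coffey2008_eq31_holds`);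
`ηₖ = −Re qₖ` (`liEta_eq_neg_re_zetaOneLogDerivCoeff`).
-/

set_option linter.dupNamespace false

namespace Summit.RiemannHypothesis.RiemannHypothesis.Theorems.LiKernel

open Literature.NumberTheory.LFunctions Literature.NumberTheory.LFunctions.Xiao2020
open Literature.NumberTheory.LFunctions.Xiao2020.CertKernel
open Literature.Analysis.ValidatedNumerics Literature.Analysis.ValidatedNumerics.NumericsMP
open Finset
open scoped Nat

variable {S : ℕ}

/-! ## Enclosure lemmas for the two programs -/

/-- `u_{n+1} = (−1)ⁿ γₙ / n!` on real parts. -/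
lemma uR_succ (n : ℕ) : uR (n + 1) = (-1) ^ n * stieltjesGamma n / n ! := by
  rw [uR, Coffey2008_eq31_holds n, Complex.ofReal_re]

/-- Length of `gammaSeq`. -/
@[simp] lemma length_gammaSeq (U : List MI) : ∀ (f : ℤ) (n c : ℕ), (gammaSeq U f n c).length = c
  | _, _, 0 => rfl
  | f, n, c + 1 => by simp [gammaSeq, length_gammaSeq]

/-- `gammaSeq` encloses `j ↦ γ_{n+j}`. -/
lemma encl_gammaSeq {U : List MI} (hU : Encl SC uR U) (hUl : U.length = IMAX + 1) :
    ∀ (c n : ℕ) (f : ℤ), f = (-1) ^ n * (n ! : ℤ) → n + c ≤ IMAX →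
      Encl SC (fun j ↦ stieltjesGamma (n + j)) (gammaSeq U f n c)
  | 0, _, _, _, _ => trivial
  | c + 1, n, f, hf, hc => by
    simp only [gammaSeq]
    refine ⟨?_, ?_⟩
    · have hu := hU.getD (i := n + 1) (by rw [hUl]; omega)
      have := MI.mem_mulInt hu f
      simp only [Nat.add_zero]
      convert this using 2
      rw [hf, uR_succ]
      push_cast
      have hn : (n ! : ℝ) ≠ 0 := by positivity
      rcases Nat.even_or_odd n with he | ho
      · rw [he.neg_one_pow]; field_simp
      · rw [ho.neg_one_pow]; field_simp
    · have := encl_gammaSeq hU hUl c (n + 1) (f * (-((n : ℤ) + 1)))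
        (by rw [hf]; push_cast [Nat.factorial_succ]; ring) (by omega)
      exact this.congr' fun j ↦ by simp [add_assoc, add_comm 1 j]

/-- `Encl` survives `List.take`. -/
lemma encl_take {f : ℕ → ℝ} : ∀ {L : List MI} (c : ℕ), Encl S f L → Encl S f (L.take c)
  | [], c, _ => by simp
  | I :: L, 0, _ => by simp
  | I :: L, c + 1, h => ⟨h.1, encl_take c h.2⟩

/-- `Encl` of the negated boxes. -/
lemma encl_map_neg {f : ℕ → ℝ} : ∀ {L : List MI}, Encl S f L → Encl S (fun i ↦ -f i) (L.map MI.neg)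
  | [], _ => by simp
  | I :: L, h => ⟨MI.mem_neg h.1, encl_map_neg h.2⟩

/-- `etaSeq` encloses `k ↦ ηₖ = liEta k`. -/
lemma encl_etaSeq {Q : List MI} (hQ : Encl SC qR Q) (c : ℕ) : Encl SC liEta (etaSeq Q c) := by
  have := encl_map_neg (encl_take c hQ)
  refine this.congr' fun k ↦ ?_
  rw [liEta_eq_neg_re_zetaOneLogDerivCoeff, qR]

/-! ## Reading the checks -/

/-- What `checkBoxes … = true` says, entry by entry. -/
lemma checkBoxes_spec (S : ℕ) : ∀ (T : List (ℕ × ℤ × ℤ)) (Bs : List MI), checkBoxes S Bs T = true →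
    Bs.length = T.length ∧ ∀ i < T.length, boxOK S (Bs.getD i zeroI) (T.getD i (0, 0, 0)) = true
  | [], Bs, h => by
    cases Bs with
    | nil => simp
    | cons B Bs => simp [checkBoxes] at h
  | r :: rs, Bs, h => by
    cases Bs with
    | nil => simp [checkBoxes] at h
    | cons B Bs =>
      simp only [checkBoxes, Bool.and_eq_true] at h
      obtain ⟨hl, hrows⟩ := checkBoxes_spec S rs Bs h.2
      refine ⟨by simp [hl], fun i hi ↦ ?_⟩
      cases i with
      | zero => simpa using h.1
      | succ i => simpa using hrows i (by simpa using hi)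

/-- What `checkEta … = true` says, entry by entry (index `i` of the list is `k = k₀ + i`). -/
lemma checkEta_spec (S : ℕ) : ∀ (Bs : List MI) (k₀ : ℕ), checkEta S Bs k₀ = true →
    ∀ i < Bs.length,
      ((k₀ + i) % 2 = 0 → (Bs.getD i zeroI).hi < 0 ∧
        (k₀ + i ≠ 0 → -(Bs.getD i zeroI).lo * 2 ^ (k₀ + i) * 10000 ≤ 5772 * (S : ℤ))) ∧
      ((k₀ + i) % 2 = 1 → 0 < (Bs.getD i zeroI).lo ∧
        (Bs.getD i zeroI).hi * 2 ^ (k₀ + i) * 10000 ≤ 5772 * (S : ℤ))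
  | [], _, _, i, hi => by simp at hi
  | B :: Bs, k₀, h, i, hi => by
    simp only [checkEta, Bool.and_eq_true] at h
    obtain ⟨hB, hrest⟩ := h
    cases i with
    | zero =>
      simp only [Nat.add_zero, List.getD_cons_zero]
      by_cases hk : k₀ % 2 = 0
      · rw [if_pos hk] at hB
        simp only [Bool.and_eq_true, Bool.or_eq_true, decide_eq_true_eq] at hB
        refine ⟨fun _ ↦ ⟨hB.1, fun hne ↦ ?_⟩, fun h1 ↦ by omega⟩
        rcases hB.2 with h0 | h0
        · exact absurd h0 hne
        · exact h0
      · rw [if_neg hk] at hB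
        simp only [Bool.and_eq_true, decide_eq_true_eq] at hB
        exact ⟨fun h0 ↦ absurd h0 hk, fun _ ↦ hB⟩
    | succ i =>
      have := checkEta_spec S Bs (k₀ + 1) hrest i (by simpa using hi)
      simp only [List.getD_cons_succ]
      rw [show k₀ + (i + 1) = k₀ + 1 + i by omega]
      exact this

/-- `gTable` has `37` rows. -/
lemma length_gTable : gTable.length = 37 := by decide
/-- `eTable` has `92` rows. -/
lemma length_eTable : eTable.length = 92 := by decide

/-! ## Soundness of the certificate -/

/-- **Soundness (Taylor side).** If the kernel evaluates `certT` to `true`: the Stieltjes constants `γₙ`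
(`n ≤ 36`) and the coefficients `ηₖ` (`k ≤ 91`) lie in their table rows, `(−1)^{k+1} ηₖ > 0` and,
for `1 ≤ k`, `|ηₖ|·2ᵏ ≤ 0.5772`. -/
theorem certT_sound (h : certT = true) :
    (∀ n, n ≤ 36 → (gLo n : ℝ) / 10 ^ gDigits n ≤ stieltjesGamma n ∧
      stieltjesGamma n ≤ (gHi n : ℝ) / 10 ^ gDigits n) ∧
    (∀ k, k ≤ 91 → ((eLo k : ℝ) / 10 ^ eDigits k ≤ liEta k ∧ liEta k ≤ (eHi k : ℝ) / 10 ^ eDigits k) ∧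
      0 < (-1) ^ (k + 1) * liEta k ∧ (1 ≤ k → |liEta k| * 2 ^ k ≤ 0.5772)) := by
  unfold certT at h
  split at h
  · exact absurd h (by simp)
  · rename_i U hU
    have hS : 0 < SC := by simp [SC]
    have hSr : (0 : ℝ) < (SC : ℝ) := by exact_mod_cast hS
    obtain ⟨hUl, hUe⟩ := uList_spec hU
    obtain ⟨hQl, hQe⟩ := qList_spec hUe hUl
    unfold certTRows at h
    simp only [Bool.and_eq_true] at h
    obtain ⟨⟨hg, he⟩, halt⟩ := h
    have hG := encl_gammaSeq hUe hUl 37 0 1 (by simp) (by simp [IMAX])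
    have hE := encl_etaSeq hQe 92
    have hEl : (etaSeq (qList U) 92).length = 92 := by simp [etaSeq, hQl, IMAX]
    obtain ⟨-, hgrow⟩ := checkBoxes_spec SC gTable _ hg
    obtain ⟨-, herow⟩ := checkBoxes_spec SC eTable _ he
    refine ⟨fun n hn ↦ ?_, fun k hk ↦ ?_⟩
    · have hmem := hG.getD (i := n) (by rw [length_gammaSeq]; omega)
      simp only [Nat.zero_add] at hmem
      have hr := hgrow n (by rw [length_gTable]; omega)
      simp only [boxOK, Bool.and_eq_true, decide_eq_true_eq] at hr
      exact bounds_of_test hS hmem hr.1 hr.2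
    · have hmem := hE.getD (i := k) (by rw [hEl]; omega)
      have hr := herow k (by rw [length_eTable]; omega)
      simp only [boxOK, Bool.and_eq_true, decide_eq_true_eq] at hr
      have hck := checkEta_spec SC _ 0 halt k (by rw [hEl]; omega)
      simp only [Nat.zero_add] at hck
      obtain ⟨h1, h2⟩ := hmem
      refine ⟨bounds_of_test hS ⟨h1, h2⟩ hr.1 hr.2, ?_, fun hk1 ↦ ?_⟩
      · rcases Nat.mod_two_eq_zero_or_one k with hpar | hpar
        · obtain ⟨hhi, -⟩ := hck.1 hpar
          have hneg : liEta k < 0 := MI.neg_of_hi_neg ⟨h1, h2⟩ hhi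
          have hodd : Odd (k + 1) := by rw [Nat.odd_iff]; omega
          rw [hodd.neg_one_pow]
          linarith
        · obtain ⟨hlo, -⟩ := hck.2 hpar
          have hpos : 0 < liEta k := MI.pos_of_lo_pos ⟨h1, h2⟩ hlo
          have heven : Even (k + 1) := by rw [Nat.even_iff]; omega
          rw [heven.neg_one_pow]
          linarith
      · have h2k : (0 : ℝ) < 2 ^ k := by positivity
        rcases Nat.mod_two_eq_zero_or_one k with hpar | hpar
        · obtain ⟨hhi, hmag⟩ := hck.1 hpar
          have hmag := hmag (by omega)
          have hneg : liEta k < 0 := MI.neg_of_hi_neg ⟨h1, h2⟩ hhi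
          have hmag' : -((etaSeq (qList U) 92).getD k zeroI).lo * (2 : ℝ) ^ k * 10000 ≤ 5772 * (SC : ℝ) := by
            exact_mod_cast hmag
          rw [abs_of_neg hneg]
          nlinarith
        · obtain ⟨hlo, hmag⟩ := hck.2 hpar
          have hpos : 0 < liEta k := MI.pos_of_lo_pos ⟨h1, h2⟩ hlo
          have hmag' : ((etaSeq (qList U) 92).getD k zeroI).hi * (2 : ℝ) ^ k * 10000 ≤ 5772 * (SC : ℝ) := by
            exact_mod_cast hmag
          rw [abs_of_pos hpos]
          nlinarith

/-! ## The exported rows -/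

/-- **Row `n` for the Stieltjes constant `γₙ`** (`0 ≤ n ≤ 36`): `γₙ ∈ [gLo n, gHi n]·10^{−gDigits n}`.
RH-FREE DATA. -/
theorem stieltjesGamma_mem_row {n : ℕ} (hn : n ≤ 36) :
    (gLo n : ℝ) / 10 ^ gDigits n ≤ stieltjesGamma n ∧ stieltjesGamma n ≤ (gHi n : ℝ) / 10 ^ gDigits n :=
  (certT_sound certT_true).1 n hn

/-- **Row `k` for `ηₖ = liEta k`** (`0 ≤ k ≤ 91`): `ηₖ ∈ [eLo k, eHi k]·10^{−eDigits k}`. RH-FREE DATA. -/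
theorem liEta_mem_row {k : ℕ} (hk : k ≤ 91) :
    (eLo k : ℝ) / 10 ^ eDigits k ≤ liEta k ∧ liEta k ≤ (eHi k : ℝ) / 10 ^ eDigits k :=
  ((certT_sound certT_true).2 k hk).1

/-- **The `ηₖ` alternate strictly in sign, `(−1)^{k+1} ηₖ > 0`, for `0 ≤ k ≤ 91`** — kernel instances of
Coffey 2005, Conjecture 1 (iv) (proved for every `j` by Coffey 2006; here only the finite range, from
the boxes). RH-FREE DATA. -/
theorem liEta_alternating_of_le {k : ℕ} (hk : k ≤ 91) : 0 < (-1) ^ (k + 1) * liEta k :=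
  ((certT_sound certT_true).2 k hk).2.1

/-- **`|ηₖ| ≤ γ·2^{−k}` for `0 ≤ k ≤ 91`** — kernel instances of Coffey 2005, Conjecture 1 (iii)
(conjectural as printed; equality at `k = 0` where `η₀ = −γ`, margin `|ηₖ|2ᵏ ≤ 0.5772` for `k ≥ 1`).
RH-FREE DATA. -/
theorem abs_liEta_le_of_le {k : ℕ} (hk : k ≤ 91) :
    |liEta k| ≤ Real.eulerMascheroniConstant / 2 ^ k := by
  rcases Nat.eq_zero_or_pos k with rfl | hpos
  · have hγ : 0 < Real.eulerMascheroniConstant := by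
      linarith [Real.one_half_lt_eulerMascheroniConstant]
    rw [liEta_zero, abs_neg, abs_of_pos hγ]
    simp
  · have h := ((certT_sound certT_true).2 k hk).2.2 hpos
    have hγ := eulerMascheroniConstant_gt_d49
    rw [le_div_iff₀ (by positivity)]
    linarith

/-- `γ₁ = −0.07281584548367672486058637587490131913773633833 4…` (row 1, 47 decimals shown). -/
theorem stieltjesGamma_one_mem :
    (-0.072815845483676724860586375874901319137736338335 : ℝ) < stieltjesGamma 1 ∧
      stieltjesGamma 1 < -0.07281584548367672486058637587490131913773633833 := by
  obtain ⟨h1, h2⟩ := stieltjesGamma_mem_row (n := 1) (by norm_num)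
  have e0 : gDigits 1 = 50 := by decide
  have e1 : gLo 1 = -7281584548367672486058637587490131913773633833438 := by decide
  have e2 : gHi 1 = -7281584548367672486058637587490131913773633833430 := by decide
  rw [e0, e1] at h1
  rw [e0, e2] at h2
  norm_num at h1 h2
  exact ⟨by linarith, by linarith⟩

/-- `η₁ = 0.187546232840365224597203384605441588383944463581…` (row 1, 46 decimals shown). -/
theorem liEta_one_mem :
    (0.1875462328403652245972033846054415883839444635 : ℝ) < liEta 1 ∧
      liEta 1 < 0.1875462328403652245972033846054415883839444636 := by
  obtain ⟨h1, h2⟩ := liEta_mem_row (k := 1) (by norm_num)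
  have e0 : eDigits 1 = 49 := by decide
  have e1 : eLo 1 = 1875462328403652245972033846054415883839444635808 := by decide
  have e2 : eHi 1 = 1875462328403652245972033846054415883839444635811 := by decide
  rw [e0, e1] at h1
  rw [e0, e2] at h2
  norm_num at h1 h2
  exact ⟨by linarith, by linarith⟩

end Summit.RiemannHypothesis.RiemannHypothesis.Theorems.LiKernel
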